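import Mathlib.Tactic.DeriveFintype
import Literature.Computability.MetaComplexity.Magnification
import Literature.Computability.Complexity.NondeterministicProofs
import Literature.Computability.Complexity.StackArith
import HarnessLib

/-!
# Route UniformStream — uniform streaming witness, part 1: the power-of-two flag, the algorithm, `M₀`

Refuter evidence (crux-attack on `UniformMagnification`, stmt-PneNP-16047; it also bears on
`UniformStreamLB` stmt-PneNP-16045 and `DodgeNonuniformity` stmt-PneNP-16046): the typed UNIFORM one-pass
streaming class of route `route-PneNP-UniformStream` — a `StreamingAlgorithm` with three Mathlib `TM2`
machines (init on `encodeNat N`, update on `boolPair st [b]`, accept on the bare state) inside the single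
budget `s (Nat.log 2 N) ^ c + c`, the update/accept clauses demanded for EVERY state of length `≤` budget —
is inhabited by an honest algorithm for the power-of-two-length language.  This file: the flag
`pow2Flag N` (`N` is a power of two iff its little-endian numeral has exactly one `true` digit), the
algorithm `powAlg` (state = that one bit), and the init machine `InitTM.initTM`
(`encodeNat N ↦ [pow2Flag N]`, one digit per step, `|encodeNat N| + 1` steps).  Parts 2–3:
`DrainMachines.lean` (update / accept machines draining four symbols per step) and
`UniformClassWitness.lean` (the witness theorems).
[McKay–Murray–Williams 2019, §2 (streaming model); Arora–Barak 2009, §1.2] [folklore]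
-/

set_option linter.dupNamespace false -- `Summit.PneNP.PneNP.…`: summit = sub-problem (D-0017 single-conjunct layout)

namespace Summit.PneNP.PneNP.Theorems.UniformMagnification.Negative

open Turing Computability
open Literature.Computability.Complexity Literature.Computability.MetaComplexity
open Literature.Computability.Complexity.PairFstTM (initList_stk_self initList_stk_ne haltList_stk_self
  haltList_stk_ne)
open Literature.Computability.Complexity.TM2Comp (iterate_bind_succ)

/-! ### The power-of-two flag of a binary numeral -/

/-- Number of `true` digits of a bit string. [folklore] -/
def ones : List Bool → ℕ
  | [] => 0
  | b :: l => b.toNat + ones l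

/-- `ones` of the empty string. [folklore] -/
@[simp] theorem ones_nil : ones [] = 0 := rfl

/-- `ones` of a cons. [folklore] -/
@[simp] theorem ones_cons (b : Bool) (l : List Bool) : ones (b :: l) = b.toNat + ones l := rfl

/-- `ones` is additive. [folklore] -/
theorem ones_append (v w : List Bool) : ones (v ++ w) = ones v + ones w := by
  induction v with
  | nil => simp
  | cons b v ih => simp [ih, Nat.add_assoc]

/-- A bit string has no `true` digit iff its value is `0`. [folklore] -/
theorem ones_eq_zero_iff (v : List Bool) : ones v = 0 ↔ bitsToNat v = 0 := by
  induction v with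
  | nil => simp
  | cons b v ih => cases b <;> simp [ih]

/-- **`N` is a power of two iff its numeral `encodeNat N` has exactly one `true` digit.**
[folklore] -/
theorem ones_encodeNat_eq_one_iff (N : ℕ) : ones (encodeNat N) = 1 ↔ ∃ k, N = 2 ^ k := by
  rcases encodeNat_canonical N with h | ⟨v, hv⟩
  · have hN : N = 0 := by
      have := bitsToNat_encodeNat N
      rw [h] at this
      simpa using this.symm
    rw [h, hN]
    simp only [ones_nil, zero_ne_one, false_iff, not_exists]
    intro k hk
    exact absurd hk.symm (pow_ne_zero k two_ne_zero)
  · have hN : N = bitsToNat v + 2 ^ v.length := by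
      have := bitsToNat_encodeNat N
      rw [hv, bitsToNat_append] at this
      simpa using this.symm
    rw [hv, ones_append]
    simp only [ones_cons, Bool.toNat_true, ones_nil, Nat.add_zero, Nat.add_eq_right]
    rw [ones_eq_zero_iff]
    constructor
    · intro h0
      exact ⟨v.length, by rw [hN, h0, Nat.zero_add]⟩
    · rintro ⟨k, hk⟩
      have hlt := bitsToNat_lt v
      have h1 : 2 ^ v.length ≤ 2 ^ k := by rw [← hk, hN]; omega
      have h2 : 2 ^ k < 2 ^ (v.length + 1) := by rw [← hk, hN, pow_succ]; omega
      have hk1 : v.length ≤ k := (Nat.pow_le_pow_iff_right Nat.one_lt_two).1 h1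
      have hk2 : k < v.length + 1 := (Nat.pow_lt_pow_iff_right Nat.one_lt_two).1 h2
      obtain rfl : k = v.length := by omega
      omega

/-- Counter of the init machine: `none` = no `true` digit read yet, `some false` = exactly one,
`some true` = at least two. `bump` registers one more `true` digit. [folklore] -/
def bump : Option Bool → Option Bool
  | none => some false
  | some _ => some true

/-- Counter update on a popped symbol (`none` = empty stack: unchanged). [folklore] -/
def upd : Option Bool → Option Bool → Option Bool
  | c, some true => bump c
  | c, _ => c

/-- `upd` on `some false` is the identity. [folklore] -/
@[simp] theorem upd_some_false (c : Option Bool) : upd c (some false) = c := by cases c <;> rfl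

/-- `upd` on `some true` bumps. [folklore] -/
@[simp] theorem upd_some_true (c : Option Bool) : upd c (some true) = bump c := by cases c <;> rfl

/-- `upd` on `none` is the identity. [folklore] -/
@[simp] theorem upd_none (c : Option Bool) : upd c none = c := by cases c <;> rfl

/-- The counter after reading a string. [folklore] -/
def trk : Option Bool → List Bool → Option Bool
  | c, [] => c
  | c, b :: l => trk (upd c (some b)) l

/-- Characterisation of the counter value "exactly one". [folklore] -/
theorem trk_eq_some_false_iff :
    ∀ (l : List Bool) (c : Option Bool),
      trk c l = some false ↔ (c = none ∧ ones l = 1) ∨ (c = some false ∧ ones l = 0)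
  | [], c => by rcases c with _ | _ | _ <;> simp [trk]
  | b :: l, c => by
    rw [trk, trk_eq_some_false_iff l]
    rcases c with _ | _ | _ <;> cases b <;> simp [bump]

/-- **The power-of-two flag** computed by the init machine: the counter started at `none` ends at
"exactly one". [folklore] -/
def pow2Flag (N : ℕ) : Bool :=
  decide (trk none (encodeNat N) = some false)

/-- `pow2Flag N = true ↔ N` is a power of two. [folklore] -/
theorem pow2Flag_eq_true_iff (N : ℕ) : pow2Flag N = true ↔ ∃ k, N = 2 ^ k := by
  rw [pow2Flag, decide_eq_true_iff, trk_eq_some_false_iff, ← ones_encodeNat_eq_one_iff]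
  simp

/-! ### The streaming algorithm -/

/-- The uniform streaming algorithm for "the length is a power of two": the state is the single bit
`pow2Flag N`, updates keep the first state bit, acceptance reads it. [folklore] -/
def powAlg : StreamingAlgorithm where
  init N := [pow2Flag N]
  update _ st _ := st.take 1
  accept _ st := st.headD false

/-- Folding the update over any input keeps a one-bit state. [folklore] -/
theorem foldl_take_one (f : Bool) :
    ∀ x : List Bool, x.foldl (fun st (_ : Bool) => st.take 1) [f] = [f]
  | [] => rfl
  | _ :: x => foldl_take_one f x

/-- `powAlg` accepts exactly the words of power-of-two length. [folklore] -/
theorem powAlg_accepts_iff (x : List Bool) : powAlg.Accepts x ↔ ∃ k, x.length = 2 ^ k := by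
  rw [← pow2Flag_eq_true_iff]
  simp only [StreamingAlgorithm.Accepts, StreamingAlgorithm.finalState, StreamingAlgorithm.runFrom,
    powAlg]
  rw [foldl_take_one]
  simp

/-- `powAlg` decides `{x | ∃ k, |x| = 2 ^ k}`. [folklore] -/
theorem powAlg_decides : powAlg.Decides {x | ∃ k, x.length = 2 ^ k} :=
  fun x => powAlg_accepts_iff x

/-- `powAlg` has space `S` for any `S ≥ 1`. [folklore] -/
theorem powAlg_hasSpace (S : ℕ → ℕ) (hS : ∀ N, 1 ≤ S N) : powAlg.HasSpace S := by
  intro N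
  refine ⟨by simpa [powAlg] using hS N, fun st b _ => ?_⟩
  simp only [powAlg, List.length_take]
  exact (min_le_left _ _).trans (hS N)

/-! ### Common stack bookkeeping (two Boolean stacks) -/

/-- Stack names: input and output. [folklore] -/
inductive Stk
  | inp
  | out
  deriving DecidableEq, Fintype

/-- Stack assignment with input `i` and output `o`. [folklore] -/
def stk (i o : List Bool) : Stk → List Bool
  | .inp => i
  | .out => o

/-- The input stack of `stk`. [folklore] -/
@[simp] theorem stk_inp (i o : List Bool) : stk i o Stk.inp = i := rfl
/-- The output stack of `stk`. [folklore] -/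
@[simp] theorem stk_out (i o : List Bool) : stk i o Stk.out = o := rfl

/-- Updating the input stack. [folklore] -/
@[simp] theorem update_stk_inp (i o l : List Bool) :
    Function.update (stk i o) Stk.inp l = stk l o := by
  funext k; cases k <;> rfl

/-- Updating the output stack. [folklore] -/
@[simp] theorem update_stk_out (i o l : List Bool) :
    Function.update (stk i o) Stk.out l = stk i l := by
  funext k; cases k <;> rfl

/-! ### The init machine `M₀`: `encodeNat N ↦ [pow2Flag N]` -/

namespace InitTM

/-- States: the counter and the last popped symbol. [folklore] -/
abbrev State : Type := Option Bool × Option Bool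

/-- The program: pop one digit into the counter; on exhaustion push the flag and halt. [folklore] -/
def initProg : Unit → TM2.Stmt (fun _ : Stk => Bool) Unit State
  | _ =>
    TM2.Stmt.pop Stk.inp (fun v a => (upd v.1 a, a)) <|
      TM2.Stmt.branch (fun v => v.2.isNone)
        (TM2.Stmt.push Stk.out (fun v => decide (v.1 = some false)) <|
          TM2.Stmt.load (fun _ => (none, none)) TM2.Stmt.halt)
        (TM2.Stmt.goto fun _ => ())

/-- The init machine. [folklore] -/
def initTM : FinTM2 where
  K := Stk
  kDecidableEq := inferInstance
  kFin := inferInstance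
  k₀ := Stk.inp
  k₁ := Stk.out
  Γ := fun _ => Bool
  Λ := Unit
  main := ()
  ΛFin := inferInstance
  σ := State
  initialState := (none, none)
  σFin := inferInstance
  Γk₀Fin := inferInstanceAs (Fintype Bool)
  m := initProg

/-- Configurations of the init machine. [folklore] -/
def cfg (l : Option Unit) (v : State) (i o : List Bool) : initTM.Cfg :=
  ⟨l, v, stk i o⟩

/-- One digit: update the counter. [folklore] -/
theorem step_cons (c x : Option Bool) (b : Bool) (rest o : List Bool) :
    initTM.step (cfg (some ()) (c, x) (b :: rest) o) =
      some (cfg (some ()) (upd c (some b), some b) rest o) := by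
  show TM2.step initProg _ = _
  simp [cfg, TM2.step, initProg, TM2.stepAux]
  rfl

/-- Exhausted input: push the flag, clear the registers, halt. [folklore] -/
theorem step_nil (c x : Option Bool) (o : List Bool) :
    initTM.step (cfg (some ()) (c, x) [] o) =
      some (cfg none (none, none) [] (decide (c = some false) :: o)) := by
  show TM2.step initProg _ = _
  simp [cfg, TM2.step, initProg, TM2.stepAux]
  rfl

/-- The whole run from counter `c`. [folklore] -/
theorem iterate_run :
    ∀ (l : List Bool) (c x : Option Bool) (o : List Bool),
      (flip bind initTM.step)^[l.length + 1] (some (cfg (some ()) (c, x) l o)) =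
        some (cfg none (none, none) [] (decide (trk c l = some false) :: o))
  | [], c, x, o => by
    rw [List.length_nil, Nat.zero_add, iterate_bind_succ, Function.iterate_zero_apply, step_nil]
    rfl
  | b :: l, c, x, o => by
    rw [List.length_cons, iterate_bind_succ, step_cons, iterate_run l]
    rfl

/-- The initial configuration on `z`. [folklore] -/
theorem initList_eq (z : List Bool) : initList initTM z = cfg (some ()) (none, none) z [] := by
  refine TM2.Cfg.mk.injEq _ _ _ _ _ _ |>.mpr ⟨rfl, rfl, ?_⟩
  funext k
  cases k
  · exact initList_stk_self initTM z
  · exact initList_stk_ne initTM z (k := Stk.out) (fun h => Stk.noConfusion h)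

/-- The halting configuration with output `o`. [folklore] -/
theorem haltList_eq (o : List Bool) : haltList initTM o = cfg none (none, none) [] o := by
  refine TM2.Cfg.mk.injEq _ _ _ _ _ _ |>.mpr ⟨rfl, rfl, ?_⟩
  funext k
  cases k
  · exact haltList_stk_ne initTM o (k := Stk.inp) (fun h => Stk.noConfusion h)
  · exact haltList_stk_self initTM o

/-- The bundled init machine. [folklore] -/
def aux : TM2ComputableAux Bool Bool where
  tm := initTM
  inputAlphabet := Equiv.refl Bool
  outputAlphabet := Equiv.refl Bool

/-- **Running time of `M₀`**: `encodeNat N ↦ [pow2Flag N]` within `|encodeNat N| + 1` steps.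
[folklore] -/
theorem outputsWithin (N : ℕ) :
    aux.OutputsWithin (encodeNat N) [pow2Flag N] ((encodeNat N).length + 1) := by
  refine ⟨⟨⟨(encodeNat N).length + 1, ?_⟩, le_rfl⟩⟩
  change (flip bind initTM.step)^[(encodeNat N).length + 1]
      (some (initList initTM ((encodeNat N).map id))) =
    some (haltList initTM ([pow2Flag N].map id))
  rw [List.map_id, List.map_id, initList_eq, haltList_eq]
  exact iterate_run (encodeNat N) none none []

end InitTM


end Summit.PneNP.PneNP.Theorems.UniformMagnification.Negative
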